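import Summits.Ventures.YMGap.RobustBall.ZdPairwiseClustering
import Summits.Ventures.YMGap.RobustBall.ZdPairwiseSharp
import Summits.Ventures.YMGap.Thresholds.OneLinkVarianceSD
import HarnessLib

/-!
# Robust ball (Y2) — `ℓ∞`-separation clustering at the axis rate: further cells — `SU(2)` `d = 4` at `β_W = 1/16`, `1/5`, and HYPOTHESIS-FREE `SU(3)` on `ℤ⁴`, `ℤ³`

HONEST FRAMING: venture file of the cell `pub-ymgap` (QuantumFields programme), track ROBUST-BALL, seat rb-p2 (g11).  Strong-coupling LATTICE cells of
`ZdPairwiseClustering.ym_abs_cov_le_linfty` / `ZdPairwiseSharp.ym_abs_cov_le_linfty_sharp` (every DLR state of the `SU(N)` Wilson specification on `ℤ^d`, all bounded measurable local Lipschitz `f, g` with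
supports at `ℓ∞`-distance `≥ n`: `|cov_μ(f,g)| ≤ (4N/(θ(1−s)))(Σδ_g)(Σδ_f) θ^{2n}`).  `SU(2)`: quarter modulus `K = 1` (tree coupling `β_W/2`, 't Hooft `β_W/4`);
`SU(3)`: the tree's HYPOTHESIS-FREE one-link modulus `OneLinkVarianceSD.su3_oneLinkKRModulus_pv_of_le` (`K_PV(3,R) = (3R/2 + √(1+9R²/4))/√(1/2 − R)`, rational
certificates `q, p`; tree coupling `β_W/3`, 't Hooft `β_W/9`, radius `2(d−1)β_W/9`).  The rates are Dobrushin-comparison floors, not computations of the mass gap;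
nothing continuum / spectral / Clay.
* `su2_abs_cov_le_linfty_sharp_oneSixteenth` — `d = 4`, `β_W = 1/16`, sharp form: `θ = 1/6`, `s₀ = 1/5`, constant `60`, rate `2 log 6 = 3.58`;
* `su2_abs_cov_le_linfty_sharp_oneFifth` — `d = 4`, `β_W = 1/5`, sharp form: `θ = 3/5`, `s₀ = 2/3`, constant `40`, rate `2 log(5/3) = 1.02`;
* `su3_abs_cov_le_linfty_sharp_dim4_oneEighth` — `SU(3)`, `d = 4`, `β_W = 1/8`, sharp form: `θ = 1/4`, `s₀ = 1/4`, constant `64`, rate `2 log 4 = 2.77`;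
* `su3_abs_cov_le_linfty_dim4_oneEighth` — `SU(3)`, `d = 4`, `β_W = 1/8` (radius `1/12`, `K = 44/25 ≥ K_PV = 1.756`): `θ = 1/4`, `s = 9/10`, constant `480`, rate
  `2 log 4 = 2.77` (`(44/25)(1/72)·max(31.5, 36.5625) = 0.8938 ≤ 0.9`);
* `perturbedYM_abs_cov_le_linfty_sharp`, `memBallZdG_abs_cov_le_linfty_sharp` — the KR door / typed tier-1 ball in the sharp form of `ZdPairwiseSharp`;
  ★★ `su2_memBallZdG_abs_cov_le_linfty_sharp_oneEighth` — the ball `MemBallZdG (1/100)(1/500) 1` at `β_W = 1/8`: constant `36` (margin form: `960`), rate `2 log 3`;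
  ★★ `su3_memBallZdG_abs_cov_le_linfty_sharp_oneEighth` — HYPOTHESIS-FREE SU(3): the ball `MemBallZdG (1/100)(1/2000) 1` at `β_W = 1/8`: constant `64`, rate `2 log 4`;
* `su2_abs_cov_le_linfty_sharp_law_dim3` — the `d = 3` LAW in the sharp form of `ZdPairwiseSharp` (`θ = √β_W`, target margin `1/2`): for `0 < β_W ≤ 1/4`,
  `|cov| ≤ (16/√β_W)(Σδ_g)(Σδ_f) β_W^n`, rate `log(1/β_W)`;
* `su3_abs_cov_le_linfty_dim3_oneQuarter` — `SU(3)`, `d = 3`, `β_W = 1/4` (radius `1/9`, `K = 19/10 ≥ K_PV = 1.894`): `θ = 9/20`, `s = 9/10`, constant `800/3`, rate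
  `2 log(20/9) = 1.60` (`(19/10)(1/36)·max(14.69, 16.49) = 0.870 ≤ 0.9`).
-/

noncomputable section

open MeasureTheory ProbabilityTheory Function Finset Real
open Literature.Probability.LatticeModels
open Literature.Probability.LatticeModels.DobrushinMetric
open Literature.MathematicalPhysics.QuantumLattice
open Literature.MathematicalPhysics.QuantumFieldTheory hiding ZdEdge
open Literature.MathematicalPhysics.QuantumFieldTheory.Balaban1983to89.StrongCouplingDobrushinWindow (OneLinkKRModulus)
open Summit.Ventures.YMGap.OneLinkVarianceSD (su3_oneLinkKRModulus_pv_of_le)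

namespace Summit.Ventures.YMGap.RobustBall.ZdAxis

variable {d N : ℕ}

/-- ★ **`SU(2)`, `d = 4`, Wilson, `β_W = 1/16`, SHARP** (tree coupling `1/32`, 't Hooft `1/64`; quarter modulus on radius `3/32`): `θ = 1/6`, target margin `s₀ = 1/5` — for
EVERY DLR state and ALL bounded measurable local Lipschitz `f, g` with supports at `ℓ∞`-distance `≥ n`: `|cov_μ(f,g)| ≤ 60 (Σδ_g)(Σδ_f)(1/6)^{2n}`, rate `2 log 6 = 3.58`
(checks: slope `(1/64)·max(43, 60.37) = 0.944 ≤ 1`; target `(1/64)·6·(4/3) = 0.125 ≤ 1/5`; rows `18/64 < 1`). [folklore] -/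
theorem su2_abs_cov_le_linfty_sharp_oneSixteenth {μ : Measure (LGConfig 4 (Matrix.specialUnitaryGroup (Fin 2) ℂ))}
    (hμ : μ ∈ ymGibbsMeasures (d := 4) (fundamentalRep (Fin 2)) (2 * (1 / 64)))
    {f g : LGConfig 4 (Matrix.specialUnitaryGroup (Fin 2) ℂ) → ℝ} (hfm : Measurable f) {Δf : Finset (ZdEdge 4)}
    (hfdep : DependsOn f (↑Δf : Set (ZdEdge 4))) {Mf : ℝ} (hMf : ∀ σ, |f σ| ≤ Mf) {δf : ZdEdge 4 → ℝ}
    (hδf : IsLipBound suFrobDist f δf) (hgm : Measurable g) {Δg : Finset (ZdEdge 4)}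
    (hgdep : DependsOn g (↑Δg : Set (ZdEdge 4))) {Mg : ℝ} (hMg : ∀ σ, |g σ| ≤ Mg) {δg : ZdEdge 4 → ℝ}
    (hδg : IsLipBound suFrobDist g δg) (n : ℕ) (hdist : ∀ x ∈ Δf, ∀ y ∈ Δg, (n : ℝ) ≤ ‖x.1 - y.1‖) :
    |cov[f, g; μ]| ≤ 60 * (∑ y ∈ Δg, δg y) * (∑ x ∈ Δf, δf x) * (1 / 6 : ℝ) ^ (2 * n) := by
  have hmod := SlabAreaLawDimensions.su2_oneLinkKRModulus_of_le_one (R := 3 / 32) (by norm_num)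
  have habs : |(1 / 64 : ℝ)| = 1 / 64 := abs_of_pos (by norm_num)
  have h := ym_abs_cov_le_linfty_sharp (d := 4) (N := 2) (by norm_num) (by norm_num) (β := 1 / 64) zero_le_one
    (by rw [habs]; norm_num) hmod (by rw [habs]; norm_num) (θ := 1 / 6) (s₀ := 1 / 5) (by norm_num) (by norm_num)
    (by rw [habs]; norm_num) (by rw [habs]; norm_num) (by norm_num) hμ hfm hfdep hMf hδf hgm hgdep hMg hδg n hdist
  have e : (4 * ((2 : ℕ) : ℝ) / ((1 / 6 : ℝ) * (1 - 1 / 5))) = 60 := by norm_num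
  rw [e] at h
  exact h

/-- ★ **`SU(2)`, `d = 4`, Wilson, `β_W = 1/5`, SHARP** (tree coupling `1/10`, 't Hooft `1/20`; quarter modulus on radius `3/10`): `θ = 3/5`, target margin `s₀ = 2/3` — for EVERY
DLR state and ALL bounded measurable local Lipschitz `f, g` with supports at `ℓ∞`-distance `≥ n`: `|cov_μ(f,g)| ≤ 40 (Σδ_g)(Σδ_f)(3/5)^{2n}`, rate `2 log(5/3) = 1.02` (the tree's
row-sum rate here is `0.105`; checks: slope `(1/20)·max(19.6, 19.68) = 0.984 ≤ 1`; target `(1/20)·6·(11/5) = 0.66 ≤ 2/3`; rows `0.9 < 1`). [folklore] -/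
theorem su2_abs_cov_le_linfty_sharp_oneFifth {μ : Measure (LGConfig 4 (Matrix.specialUnitaryGroup (Fin 2) ℂ))}
    (hμ : μ ∈ ymGibbsMeasures (d := 4) (fundamentalRep (Fin 2)) (2 * (1 / 20)))
    {f g : LGConfig 4 (Matrix.specialUnitaryGroup (Fin 2) ℂ) → ℝ} (hfm : Measurable f) {Δf : Finset (ZdEdge 4)}
    (hfdep : DependsOn f (↑Δf : Set (ZdEdge 4))) {Mf : ℝ} (hMf : ∀ σ, |f σ| ≤ Mf) {δf : ZdEdge 4 → ℝ}
    (hδf : IsLipBound suFrobDist f δf) (hgm : Measurable g) {Δg : Finset (ZdEdge 4)}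
    (hgdep : DependsOn g (↑Δg : Set (ZdEdge 4))) {Mg : ℝ} (hMg : ∀ σ, |g σ| ≤ Mg) {δg : ZdEdge 4 → ℝ}
    (hδg : IsLipBound suFrobDist g δg) (n : ℕ) (hdist : ∀ x ∈ Δf, ∀ y ∈ Δg, (n : ℝ) ≤ ‖x.1 - y.1‖) :
    |cov[f, g; μ]| ≤ 40 * (∑ y ∈ Δg, δg y) * (∑ x ∈ Δf, δf x) * (3 / 5 : ℝ) ^ (2 * n) := by
  have hmod := SlabAreaLawDimensions.su2_oneLinkKRModulus_of_le_one (R := 3 / 10) (by norm_num)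
  have habs : |(1 / 20 : ℝ)| = 1 / 20 := abs_of_pos (by norm_num)
  have h := ym_abs_cov_le_linfty_sharp (d := 4) (N := 2) (by norm_num) (by norm_num) (β := 1 / 20) zero_le_one
    (by rw [habs]; norm_num) hmod (by rw [habs]; norm_num) (θ := 3 / 5) (s₀ := 2 / 3) (by norm_num) (by norm_num)
    (by rw [habs]; norm_num) (by rw [habs]; norm_num) (by norm_num) hμ hfm hfdep hMf hδf hgm hgdep hMg hδg n hdist
  have e : (4 * ((2 : ℕ) : ℝ) / ((3 / 5 : ℝ) * (1 - 2 / 3))) = 40 := by norm_num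
  rw [e] at h
  exact h

/-- ★ **`SU(3)`, `d = 4`, Wilson, `β_W = 1/8`, HYPOTHESIS-FREE, SHARP** (PV modulus `K = 44/25` on radius `1/12`): `θ = 1/4`, target margin `s₀ = 1/4` — for EVERY DLR state and
ALL bounded measurable local Lipschitz `f, g` with supports at `ℓ∞`-distance `≥ n`: `|cov_μ(f,g)| ≤ 64 (Σδ_g)(Σδ_f)(1/4)^{2n}`, rate `2 log 4 = 2.77` (checks: slope
`(44/25)(1/72)·36.5625 = 0.894 ≤ 1`; target `(44/25)(1/72)·6·(3/2) = 0.22 ≤ 1/4`; rows `0.44 < 1`). [folklore] -/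
theorem su3_abs_cov_le_linfty_sharp_dim4_oneEighth {μ : Measure (LGConfig 4 (Matrix.specialUnitaryGroup (Fin 3) ℂ))}
    (hμ : μ ∈ ymGibbsMeasures (d := 4) (fundamentalRep (Fin 3)) (3 * (1 / 72)))
    {f g : LGConfig 4 (Matrix.specialUnitaryGroup (Fin 3) ℂ) → ℝ} (hfm : Measurable f) {Δf : Finset (ZdEdge 4)}
    (hfdep : DependsOn f (↑Δf : Set (ZdEdge 4))) {Mf : ℝ} (hMf : ∀ σ, |f σ| ≤ Mf) {δf : ZdEdge 4 → ℝ}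
    (hδf : IsLipBound suFrobDist f δf) (hgm : Measurable g) {Δg : Finset (ZdEdge 4)}
    (hgdep : DependsOn g (↑Δg : Set (ZdEdge 4))) {Mg : ℝ} (hMg : ∀ σ, |g σ| ≤ Mg) {δg : ZdEdge 4 → ℝ}
    (hδg : IsLipBound suFrobDist g δg) (n : ℕ) (hdist : ∀ x ∈ Δf, ∀ y ∈ Δg, (n : ℝ) ≤ ‖x.1 - y.1‖) :
    |cov[f, g; μ]| ≤ 64 * (∑ y ∈ Δg, δg y) * (∑ x ∈ Δf, δf x) * (1 / 4 : ℝ) ^ (2 * n) := by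
  have hmod : OneLinkKRModulus 3 (1 / 12) (44 / 25) :=
    su3_oneLinkKRModulus_pv_of_le (q := 126 / 125) (p := 31 / 20)
      (by norm_num) (by norm_num) (by norm_num) (by norm_num) (by norm_num) (by norm_num) (by norm_num)
  have habs : |(1 / 72 : ℝ)| = 1 / 72 := abs_of_pos (by norm_num)
  have h := ym_abs_cov_le_linfty_sharp (d := 4) (N := 3) (by norm_num) (by norm_num) (β := 1 / 72) (K := 44 / 25) (by norm_num)
    (by rw [habs]; norm_num) hmod (by rw [habs]; norm_num) (θ := 1 / 4) (s₀ := 1 / 4) (by norm_num) (by norm_num)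
    (by rw [habs]; norm_num) (by rw [habs]; norm_num) (by norm_num) hμ hfm hfdep hMf hδf hgm hgdep hMg hδg n hdist
  have e : (4 * ((3 : ℕ) : ℝ) / ((1 / 4 : ℝ) * (1 - 1 / 4))) = 64 := by norm_num
  rw [e] at h
  exact h

/-- ★ **`SU(3)`, `d = 4`, Wilson, `β_W = 1/8`, HYPOTHESIS-FREE** (tree coupling `1/24`, 't Hooft `1/72`; PV modulus `K = 44/25` on radius `1/12`, certificates
`q = 126/125`, `p = 31/20`): `θ = 1/4`, `s = 9/10` — for EVERY DLR state and ALL bounded measurable local Lipschitz `f, g` with supports at `ℓ∞`-distance `≥ n`: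
`|cov_μ(f,g)| ≤ 480 (Σδ_g)(Σδ_f)(1/4)^{2n}`, rate `2 log 4 = 2.77` per lattice unit. [folklore] -/
theorem su3_abs_cov_le_linfty_dim4_oneEighth {μ : Measure (LGConfig 4 (Matrix.specialUnitaryGroup (Fin 3) ℂ))}
    (hμ : μ ∈ ymGibbsMeasures (d := 4) (fundamentalRep (Fin 3)) (3 * (1 / 72)))
    {f g : LGConfig 4 (Matrix.specialUnitaryGroup (Fin 3) ℂ) → ℝ} (hfm : Measurable f) {Δf : Finset (ZdEdge 4)}
    (hfdep : DependsOn f (↑Δf : Set (ZdEdge 4))) {Mf : ℝ} (hMf : ∀ σ, |f σ| ≤ Mf) {δf : ZdEdge 4 → ℝ}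
    (hδf : IsLipBound suFrobDist f δf) (hgm : Measurable g) {Δg : Finset (ZdEdge 4)}
    (hgdep : DependsOn g (↑Δg : Set (ZdEdge 4))) {Mg : ℝ} (hMg : ∀ σ, |g σ| ≤ Mg) {δg : ZdEdge 4 → ℝ}
    (hδg : IsLipBound suFrobDist g δg) (n : ℕ) (hdist : ∀ x ∈ Δf, ∀ y ∈ Δg, (n : ℝ) ≤ ‖x.1 - y.1‖) :
    |cov[f, g; μ]| ≤ 480 * (∑ y ∈ Δg, δg y) * (∑ x ∈ Δf, δf x) * (1 / 4 : ℝ) ^ (2 * n) := by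
  have hmod : OneLinkKRModulus 3 (1 / 12) (44 / 25) :=
    su3_oneLinkKRModulus_pv_of_le (q := 126 / 125) (p := 31 / 20)
      (by norm_num) (by norm_num) (by norm_num) (by norm_num) (by norm_num) (by norm_num) (by norm_num)
  have habs : |(1 / 72 : ℝ)| = 1 / 72 := abs_of_pos (by norm_num)
  have h := ym_abs_cov_le_linfty (d := 4) (N := 3) (by norm_num) (by norm_num) (β := 1 / 72) (K := 44 / 25) (by norm_num)
    (by rw [habs]; norm_num) hmod (θ := 1 / 4) (s := 9 / 10) (by norm_num) (by norm_num) (by norm_num)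
    (by rw [habs]; norm_num) hμ hfm hfdep hMf hδf hgm hgdep hMg hδg n hdist
  have e : (4 * ((3 : ℕ) : ℝ) / ((1 / 4 : ℝ) * (1 - 9 / 10))) = 480 := by norm_num
  rw [e] at h
  exact h

/-- ★ **`SU(3)`, `d = 3`, Wilson, `β_W = 1/4`, HYPOTHESIS-FREE** (tree coupling `1/12`, 't Hooft `1/36`; PV modulus `K = 19/10` on radius `1/9`, certificates
`q = 507/500`, `p = 401/250`): `θ = 9/20`, `s = 9/10` — for EVERY DLR state and ALL bounded measurable local Lipschitz `f, g` with supports at `ℓ∞`-distance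
`≥ n`: `|cov_μ(f,g)| ≤ (800/3)(Σδ_g)(Σδ_f)(9/20)^{2n}`, rate `2 log(20/9) = 1.60` per lattice unit. [folklore] -/
theorem su3_abs_cov_le_linfty_dim3_oneQuarter {μ : Measure (LGConfig 3 (Matrix.specialUnitaryGroup (Fin 3) ℂ))}
    (hμ : μ ∈ ymGibbsMeasures (d := 3) (fundamentalRep (Fin 3)) (3 * (1 / 36)))
    {f g : LGConfig 3 (Matrix.specialUnitaryGroup (Fin 3) ℂ) → ℝ} (hfm : Measurable f) {Δf : Finset (ZdEdge 3)}
    (hfdep : DependsOn f (↑Δf : Set (ZdEdge 3))) {Mf : ℝ} (hMf : ∀ σ, |f σ| ≤ Mf) {δf : ZdEdge 3 → ℝ}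
    (hδf : IsLipBound suFrobDist f δf) (hgm : Measurable g) {Δg : Finset (ZdEdge 3)}
    (hgdep : DependsOn g (↑Δg : Set (ZdEdge 3))) {Mg : ℝ} (hMg : ∀ σ, |g σ| ≤ Mg) {δg : ZdEdge 3 → ℝ}
    (hδg : IsLipBound suFrobDist g δg) (n : ℕ) (hdist : ∀ x ∈ Δf, ∀ y ∈ Δg, (n : ℝ) ≤ ‖x.1 - y.1‖) :
    |cov[f, g; μ]| ≤ 800 / 3 * (∑ y ∈ Δg, δg y) * (∑ x ∈ Δf, δf x) * (9 / 20 : ℝ) ^ (2 * n) := by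
  have hmod : OneLinkKRModulus 3 (1 / 9) (19 / 10) :=
    su3_oneLinkKRModulus_pv_of_le (q := 507 / 500) (p := 401 / 250)
      (by norm_num) (by norm_num) (by norm_num) (by norm_num) (by norm_num) (by norm_num) (by norm_num)
  have habs : |(1 / 36 : ℝ)| = 1 / 36 := abs_of_pos (by norm_num)
  have h := ym_abs_cov_le_linfty (d := 3) (N := 3) (by norm_num) (by norm_num) (β := 1 / 36) (K := 19 / 10) (by norm_num)
    (by rw [habs]; norm_num) hmod (θ := 9 / 20) (s := 9 / 10) (by norm_num) (by norm_num) (by norm_num)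
    (by rw [habs]; norm_num) hμ hfm hfdep hMf hδf hgm hgdep hMg hδg n hdist
  have e : (4 * ((3 : ℕ) : ℝ) / ((9 / 20 : ℝ) * (1 - 9 / 10))) = 800 / 3 := by norm_num
  rw [e] at h
  exact h

/-! ### Members of the tier-1 ball, sharp form (margin at the target only) -/

/-- **KR door, SHARP FORM**: as `ZdPairwiseClustering.perturbedYM_abs_cov_le_linfty` (explicit loads `a, ℓ_s, Λ`, range `R ≥ 1`, `A = K e^{a}(1+2√Nℓ_s)|β|`) but with
the row condition `6(d−1)A + √NΛ < 1`, the SLOPE condition `A·P(θ) + √NΛθ⁻¹^{2R+1} ≤ 1` and the TARGET condition `A·2(d−1)(2θ+1) + √NΛ ≤ s₀ < 1`: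
`|cov_μ(f,g)| ≤ (4N/(θ(1−s₀)))(Σδ_g)(Σδ_f) θ^{2n}`. [folklore] -/
theorem perturbedYM_abs_cov_le_linfty_sharp (hd : 2 ≤ d) (hN : 1 ≤ N) {β b K a ℓs Λ : ℝ} (hK : 0 ≤ K) (hℓs : 0 ≤ ℓs)
    (hb : |β| * (2 * ((d : ℝ) - 1)) ≤ b) (hmod : OneLinkKRModulus N b K)
    {W : Potential (ZdEdge d) (Matrix.specialUnitaryGroup (Fin N) ℂ)} (hW : W.IsAdapted) (hWb : ∀ X, ∃ C, ∀ U, |W X U| ≤ C)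
    {supp : Finset (ZdEdge d) → Finset (Finset (ZdEdge d))} (hsupp : W.IsSupportedBy supp)
    {osc : Finset (ZdEdge d) → ZdEdge d → ℝ} (hosc : ∀ X, Dobrushin.IsOscBound (W X) (osc X))
    (hosca : ∀ e, ∑ X ∈ (supp {e}).filter (fun X => e ∈ X), osc X e ≤ a)
    {lip : Finset (ZdEdge d) → ZdEdge d → ℝ} (hlip : ∀ X, IsLipBound suFrobDist (W X) (lip X))
    (hlips : ∀ e, ∑ X ∈ (supp {e}).filter (fun X => e ∈ X), lip X e ≤ ℓs)
    (hΛ : ∀ e, ∑ y ∈ perturbedNbr supp e, ∑ X ∈ (supp {e}).filter (fun X => e ∈ X), lip X y ≤ Λ)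
    {R : ℕ} (hR1 : 1 ≤ R) (hR : ∀ e, ∀ X ∈ supp {e}, e ∈ X → ∀ y ∈ X, ‖e.1 - y.1‖ ≤ (R : ℝ))
    (hρ : K * exp a * (1 + 2 * Real.sqrt N * ℓs) * |β| * (6 * ((d : ℝ) - 1)) + Real.sqrt N * Λ < 1)
    {θ s₀ : ℝ} (hθ0 : 0 < θ) (hθ1 : θ ≤ 1)
    (hsup : K * exp a * (1 + 2 * Real.sqrt N * ℓs) * |β| *
        max (2 * ((d : ℝ) - 1) * (θ + θ⁻¹ + 1)) (θ⁻¹ ^ 2 + 2 * θ⁻¹ + 2 * θ + θ ^ 2 + 6 * ((d : ℝ) - 2)) +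
      Real.sqrt N * Λ * θ⁻¹ ^ (2 * R + 1) ≤ 1)
    (hs0 : K * exp a * (1 + 2 * Real.sqrt N * ℓs) * |β| * (2 * ((d : ℝ) - 1) * (2 * θ + 1)) + Real.sqrt N * Λ ≤ s₀) (hs1 : s₀ < 1)
    {μ : Measure (LGConfig d (Matrix.specialUnitaryGroup (Fin N) ℂ))}
    (hμ : μ ∈ perturbedGibbsMeasures (d := d) (fundamentalRep (Fin N)) (N * β) W supp)
    {f g : LGConfig d (Matrix.specialUnitaryGroup (Fin N) ℂ) → ℝ} (hfm : Measurable f) {Δf : Finset (ZdEdge d)}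
    (hfdep : DependsOn f (↑Δf : Set (ZdEdge d))) {Mf : ℝ} (hMf : ∀ σ, |f σ| ≤ Mf) {δf : ZdEdge d → ℝ}
    (hδf : IsLipBound suFrobDist f δf) (hgm : Measurable g) {Δg : Finset (ZdEdge d)}
    (hgdep : DependsOn g (↑Δg : Set (ZdEdge d))) {Mg : ℝ} (hMg : ∀ σ, |g σ| ≤ Mg) {δg : ZdEdge d → ℝ}
    (hδg : IsLipBound suFrobDist g δg) (n : ℕ) (hdist : ∀ x ∈ Δf, ∀ y ∈ Δg, (n : ℝ) ≤ ‖x.1 - y.1‖) :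
    |cov[f, g; μ]| ≤ 4 * N / (θ * (1 - s₀)) * (∑ y ∈ Δg, δg y) * (∑ x ∈ Δf, δf x) * θ ^ (2 * n) := by
  classical
  haveI : SecondCountableTopology (Matrix (Fin N) (Fin N) ℂ) :=
    inferInstanceAs (SecondCountableTopology (Fin N → Fin N → ℂ))
  haveI : SecondCountableTopology (Matrix.specialUnitaryGroup (Fin N) ℂ) :=
    Topology.IsEmbedding.subtypeVal.secondCountableTopology
  have hd1 : 1 ≤ d := by omega
  have hγ : IsSpecification (perturbedYM (d := d) (fundamentalRep (Fin N)) (N * β) W supp) :=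
    isSpecification_perturbedYM _ (continuous_fundamentalRep (Fin N)) _ hW hWb hsupp
  have hKR := isKRContraction_perturbedYM_of_oneLinkKRModulus hd1 hN hK hℓs hb hmod hW (supp := supp) hosc hosca hlip hlips
  have hμ' : IsGibbsMeasure (perturbedYM (d := d) (fundamentalRep (Fin N)) (N * β) W supp) μ := hμ
  set A : ℝ := K * exp a * (1 + 2 * Real.sqrt N * ℓs) * |β| with hA
  have hA0 : 0 ≤ A := by positivity
  refine abs_cov_le_linfty_of_split_sharp hd hγ hKR hA0
    (L := fun e y => Real.sqrt N * ∑ X ∈ (supp {e}).filter (fun X => e ∈ X), lip X y)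
    (fun e y => mul_nonneg (Real.sqrt_nonneg _) (Finset.sum_nonneg fun X _ => (hlip X).nonneg y))
    (fun e y _ => by rw [hA]) (Λ := Real.sqrt N * Λ)
    (fun e => by rw [← Finset.mul_sum]; exact mul_le_mul_of_nonneg_left (hΛ e) (Real.sqrt_nonneg _))
    (R := R) (fun e y hy => ?_) (by rw [hA]; exact hρ) hθ0 hθ1 (by rw [hA]; exact hsup) (by rw [hA]; exact hs0) hs1
    hμ' hfm hfdep hMf hδf hgm hgdep hMg hδg n hdist
  rcases (mem_perturbedNbr_iff.1 hy).2 with hy' | ⟨X, hX, hxX, hyX⟩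
  · exact (norm_sub_le_one_of_mem_linkPlaqNbr hy').trans (by exact_mod_cast hR1)
  · exact hR e X hX hxX y hyX

/-- **THE TYPED TIER-1 BALL, SHARP FORM**: every DLR state of every member of `MemBallZdG ε₀ ε₁ R` (`R ≥ 1`; `a = ε₀`, `ℓ_s = Λ = ε₁`), with
`A = K e^{ε₀}(1+2√Nε₁)|β|`: rows `6(d−1)A + √Nε₁ < 1`, slope `A·P(θ) + √Nε₁θ⁻¹^{2R+1} ≤ 1`, target `A·2(d−1)(2θ+1) + √Nε₁ ≤ s₀ < 1` ⇒
`|cov_μ(f,g)| ≤ (4N/(θ(1−s₀)))(Σδ_g)(Σδ_f)θ^{2n}`. [folklore] -/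
theorem memBallZdG_abs_cov_le_linfty_sharp (hd : 2 ≤ d) (hN : 1 ≤ N) {β b K ε₀ ε₁ : ℝ} {R : ℕ} (hK : 0 ≤ K) (hR1 : 1 ≤ R)
    (hb : |β| * (2 * ((d : ℝ) - 1)) ≤ b) (hmod : OneLinkKRModulus N b K)
    {W : Potential (ZdEdge d) (Matrix.specialUnitaryGroup (Fin N) ℂ)} {supp : Finset (ZdEdge d) → Finset (Finset (ZdEdge d))}
    (hmem : MemBallZdG ε₀ ε₁ R W supp)
    (hρ : K * exp ε₀ * (1 + 2 * Real.sqrt N * ε₁) * |β| * (6 * ((d : ℝ) - 1)) + Real.sqrt N * ε₁ < 1)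
    {θ s₀ : ℝ} (hθ0 : 0 < θ) (hθ1 : θ ≤ 1)
    (hsup : K * exp ε₀ * (1 + 2 * Real.sqrt N * ε₁) * |β| *
        max (2 * ((d : ℝ) - 1) * (θ + θ⁻¹ + 1)) (θ⁻¹ ^ 2 + 2 * θ⁻¹ + 2 * θ + θ ^ 2 + 6 * ((d : ℝ) - 2)) +
      Real.sqrt N * ε₁ * θ⁻¹ ^ (2 * R + 1) ≤ 1)
    (hs0 : K * exp ε₀ * (1 + 2 * Real.sqrt N * ε₁) * |β| * (2 * ((d : ℝ) - 1) * (2 * θ + 1)) + Real.sqrt N * ε₁ ≤ s₀) (hs1 : s₀ < 1)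
    {μ : Measure (LGConfig d (Matrix.specialUnitaryGroup (Fin N) ℂ))}
    (hμ : μ ∈ perturbedGibbsMeasures (d := d) (fundamentalRep (Fin N)) (N * β) W supp)
    {f g : LGConfig d (Matrix.specialUnitaryGroup (Fin N) ℂ) → ℝ} (hfm : Measurable f) {Δf : Finset (ZdEdge d)}
    (hfdep : DependsOn f (↑Δf : Set (ZdEdge d))) {Mf : ℝ} (hMf : ∀ σ, |f σ| ≤ Mf) {δf : ZdEdge d → ℝ}
    (hδf : IsLipBound suFrobDist f δf) (hgm : Measurable g) {Δg : Finset (ZdEdge d)}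
    (hgdep : DependsOn g (↑Δg : Set (ZdEdge d))) {Mg : ℝ} (hMg : ∀ σ, |g σ| ≤ Mg) {δg : ZdEdge d → ℝ}
    (hδg : IsLipBound suFrobDist g δg) (n : ℕ) (hdist : ∀ x ∈ Δf, ∀ y ∈ Δg, (n : ℝ) ≤ ‖x.1 - y.1‖) :
    |cov[f, g; μ]| ≤ 4 * N / (θ * (1 - s₀)) * (∑ y ∈ Δg, δg y) * (∑ x ∈ Δf, δf x) * θ ^ (2 * n) := by
  classical
  obtain ⟨osc, lip, hosc, hlip, hε₀, hε₁⟩ := hmem.loads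
  have hW : W.IsAdapted := fun X => ⟨hmem.dependsOn X, (hmem.continuous X).measurable⟩
  have hWb : ∀ X, ∃ C, ∀ U, |W X U| ≤ C := fun X => exists_bound_of_continuous (hmem.continuous X)
  set lip' : Finset (ZdEdge d) → ZdEdge d → ℝ := fun X y => if y ∈ X then lip X y else 0 with hlip'
  have hlipr : ∀ X, IsLipBound suFrobDist (W X) (lip' X) := fun X => (hlip X).restrict (hmem.dependsOn X)
  have hε₁0 : 0 ≤ ε₁ :=
    le_trans (Finset.sum_nonneg fun X _ => Finset.sum_nonneg fun y _ => (hlip X).nonneg y) (hε₁ (fun _ => 0))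
  have hlips : ∀ e, ∑ X ∈ (supp {e}).filter (fun X => e ∈ X), lip' X e ≤ ε₁ := by
    intro e
    calc ∑ X ∈ (supp {e}).filter (fun X => e ∈ X), lip' X e ≤ ∑ X ∈ (supp {e}).filter (fun X => e ∈ X), ∑ y ∈ X, lip X y := by
          refine Finset.sum_le_sum fun X hX => ?_
          have heX : e ∈ X := (Finset.mem_filter.1 hX).2
          simp only [hlip', if_pos heX]
          exact Finset.single_le_sum (fun y _ => (hlip X).nonneg y) heX
      _ ≤ ∑ X ∈ listedAt supp e.1, ∑ y ∈ X, lip X y :=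
          Finset.sum_le_sum_of_subset_of_nonneg (filter_supp_subset_listedAt supp e)
            fun X _ _ => Finset.sum_nonneg fun y _ => (hlip X).nonneg y
      _ ≤ ε₁ := hε₁ e.1
  have hΛ : ∀ e, ∑ y ∈ perturbedNbr supp e, ∑ X ∈ (supp {e}).filter (fun X => e ∈ X), lip' X y ≤ ε₁ := by
    intro e
    rw [Finset.sum_comm]
    calc ∑ X ∈ (supp {e}).filter (fun X => e ∈ X), ∑ y ∈ perturbedNbr supp e, lip' X y
        ≤ ∑ X ∈ (supp {e}).filter (fun X => e ∈ X), ∑ y ∈ X, lip X y := by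
          refine Finset.sum_le_sum fun X _ => ?_
          simp only [hlip']
          rw [← Finset.sum_filter]
          exact Finset.sum_le_sum_of_subset_of_nonneg (fun y hy => (Finset.mem_filter.1 hy).2) fun y _ _ => (hlip X).nonneg y
      _ ≤ ∑ X ∈ listedAt supp e.1, ∑ y ∈ X, lip X y :=
          Finset.sum_le_sum_of_subset_of_nonneg (filter_supp_subset_listedAt supp e)
            fun X _ _ => Finset.sum_nonneg fun y _ => (hlip X).nonneg y
      _ ≤ ε₁ := hε₁ e.1
  exact perturbedYM_abs_cov_le_linfty_sharp hd hN hK hε₁0 hb hmod hW hWb hmem.supportedBy hosc hε₀ hlipr hlips hΛ hR1 hmem.range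
    hρ hθ0 hθ1 hsup hs0 hs1 hμ hfm hfdep hMf hδf hgm hgdep hMg hδg n hdist

/-- ★★ **`SU(2)`, `d = 4`, the BALL `MemBallZdG (1/100) (1/500) 1` at `β_W = 1/8`, SHARP FORM**: `θ = 1/3`, target margin `s₀ = 1/3` — for EVERY member, EVERY DLR state
of the member and ALL bounded measurable local Lipschitz `f, g` with supports at `ℓ∞`-distance `≥ n`: `|cov_μ(f,g)| ≤ 36 (Σδ_g)(Σδ_f)(1/3)^{2n}`, rate `2 log 3 = 2.20`
(checks: slope `e^{1/100}(1+2√2/500)(1/32)(250/9) + √2·27/500 ≤ 0.975 ≤ 1`; target `1.0267·(10/32) + √2/500 ≤ 0.324 ≤ 1/3`; rows `1.0267·(18/32) + 0.003 < 1`). [folklore] -/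
theorem su2_memBallZdG_abs_cov_le_linfty_sharp_oneEighth {W : Potential (ZdEdge 4) (Matrix.specialUnitaryGroup (Fin 2) ℂ)}
    {supp : Finset (ZdEdge 4) → Finset (Finset (ZdEdge 4))} (hmem : MemBallZdG (1 / 100) (1 / 500) 1 W supp)
    {μ : Measure (LGConfig 4 (Matrix.specialUnitaryGroup (Fin 2) ℂ))}
    (hμ : μ ∈ perturbedGibbsMeasures (d := 4) (fundamentalRep (Fin 2)) (2 * (1 / 32)) W supp)
    {f g : LGConfig 4 (Matrix.specialUnitaryGroup (Fin 2) ℂ) → ℝ} (hfm : Measurable f) {Δf : Finset (ZdEdge 4)}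
    (hfdep : DependsOn f (↑Δf : Set (ZdEdge 4))) {Mf : ℝ} (hMf : ∀ σ, |f σ| ≤ Mf) {δf : ZdEdge 4 → ℝ}
    (hδf : IsLipBound suFrobDist f δf) (hgm : Measurable g) {Δg : Finset (ZdEdge 4)}
    (hgdep : DependsOn g (↑Δg : Set (ZdEdge 4))) {Mg : ℝ} (hMg : ∀ σ, |g σ| ≤ Mg) {δg : ZdEdge 4 → ℝ}
    (hδg : IsLipBound suFrobDist g δg) (n : ℕ) (hdist : ∀ x ∈ Δf, ∀ y ∈ Δg, (n : ℝ) ≤ ‖x.1 - y.1‖) :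
    |cov[f, g; μ]| ≤ 36 * (∑ y ∈ Δg, δg y) * (∑ x ∈ Δf, δf x) * (1 / 3 : ℝ) ^ (2 * n) := by
  have hmod := SlabAreaLawDimensions.su2_oneLinkKRModulus_of_le_one (R := 3 / 16) (by norm_num)
  have habs : |(1 / 32 : ℝ)| = 1 / 32 := abs_of_pos (by norm_num)
  have hexp : Real.exp (1 / 100 : ℝ) ≤ 51 / 50 := by
    have h := Real.exp_bound_div_one_sub_of_interval' (x := 1 / 100) (by norm_num) (by norm_num)
    have : (1 : ℝ) / (1 - 1 / 100) ≤ 51 / 50 := by norm_num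
    linarith
  have hsqrt : Real.sqrt 2 ≤ 3 / 2 := by
    rw [show (3 / 2 : ℝ) = Real.sqrt ((3 / 2) ^ 2) by rw [Real.sqrt_sq (by norm_num)]]
    exact Real.sqrt_le_sqrt (by norm_num)
  have hcast : Real.sqrt ((2 : ℕ) : ℝ) = Real.sqrt 2 := by norm_num
  have h5 : 0 ≤ Real.sqrt 2 := Real.sqrt_nonneg _
  have h3 : Real.exp (1 / 100) * (1 + 2 * Real.sqrt 2 * (1 / 500)) ≤ 51 / 50 * (1 + 2 * (3 / 2) * (1 / 500)) :=
    mul_le_mul hexp (by linarith) (by positivity) (by norm_num)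
  have hE0 : 0 < Real.exp (1 / 100 : ℝ) := Real.exp_pos _
  have h := memBallZdG_abs_cov_le_linfty_sharp (d := 4) (N := 2) (by norm_num) (by norm_num) (β := 1 / 32) (ε₀ := 1 / 100) (ε₁ := 1 / 500)
    (R := 1) (θ := 1 / 3) (s₀ := 1 / 3) zero_le_one le_rfl (by rw [habs]; norm_num) hmod hmem ?_ (by norm_num) (by norm_num) ?_ ?_ (by norm_num)
    hμ hfm hfdep hMf hδf hgm hgdep hMg hδg n hdist
  · have e : (4 * ((2 : ℕ) : ℝ) / ((1 / 3 : ℝ) * (1 - 1 / 3))) = 36 := by norm_num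
    rw [e] at h
    exact h
  · rw [habs, hcast]; push_cast; nlinarith [h3, hsqrt, h5, hE0]
  · rw [habs, hcast]
    have hmax : max (2 * (((4 : ℕ) : ℝ) - 1) * ((1 / 3 : ℝ) + (1 / 3)⁻¹ + 1))
        ((1 / 3 : ℝ)⁻¹ ^ 2 + 2 * (1 / 3 : ℝ)⁻¹ + 2 * (1 / 3) + (1 / 3) ^ 2 + 6 * (((4 : ℕ) : ℝ) - 2)) = 250 / 9 := by norm_num
    have hm1 : (2 * 1 + 1 : ℕ) = 3 := by norm_num
    rw [hmax, hm1]
    nlinarith [h3, hsqrt, h5, hE0]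
  · rw [habs, hcast]; push_cast; nlinarith [h3, hsqrt, h5, hE0]

/-- ★★ **`SU(3)`, `d = 4`, the BALL `MemBallZdG (1/100) (1/2000) 1` at `β_W = 1/8`, HYPOTHESIS-FREE, SHARP FORM** (tree coupling `1/24`, 't Hooft `1/72`; PV modulus `K = 44/25`
on radius `1/12`): `θ = 1/4`, target margin `s₀ = 1/4` — for EVERY member, EVERY DLR state of the member and ALL bounded measurable local Lipschitz `f, g` with supports at
`ℓ∞`-distance `≥ n`: `|cov_μ(f,g)| ≤ 64 (Σδ_g)(Σδ_f)(1/4)^{2n}`, rate `2 log 4 = 2.77` (checks with `e^{1/100} ≤ 51/50`, `√3 ≤ 7/4`: rows `≤ 0.45 < 1`; slope `≤ 0.97 ≤ 1`;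
target `≤ 0.226 ≤ 1/4`). [folklore] -/
theorem su3_memBallZdG_abs_cov_le_linfty_sharp_oneEighth {W : Potential (ZdEdge 4) (Matrix.specialUnitaryGroup (Fin 3) ℂ)}
    {supp : Finset (ZdEdge 4) → Finset (Finset (ZdEdge 4))} (hmem : MemBallZdG (1 / 100) (1 / 2000) 1 W supp)
    {μ : Measure (LGConfig 4 (Matrix.specialUnitaryGroup (Fin 3) ℂ))}
    (hμ : μ ∈ perturbedGibbsMeasures (d := 4) (fundamentalRep (Fin 3)) (3 * (1 / 72)) W supp)
    {f g : LGConfig 4 (Matrix.specialUnitaryGroup (Fin 3) ℂ) → ℝ} (hfm : Measurable f) {Δf : Finset (ZdEdge 4)}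
    (hfdep : DependsOn f (↑Δf : Set (ZdEdge 4))) {Mf : ℝ} (hMf : ∀ σ, |f σ| ≤ Mf) {δf : ZdEdge 4 → ℝ}
    (hδf : IsLipBound suFrobDist f δf) (hgm : Measurable g) {Δg : Finset (ZdEdge 4)}
    (hgdep : DependsOn g (↑Δg : Set (ZdEdge 4))) {Mg : ℝ} (hMg : ∀ σ, |g σ| ≤ Mg) {δg : ZdEdge 4 → ℝ}
    (hδg : IsLipBound suFrobDist g δg) (n : ℕ) (hdist : ∀ x ∈ Δf, ∀ y ∈ Δg, (n : ℝ) ≤ ‖x.1 - y.1‖) :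
    |cov[f, g; μ]| ≤ 64 * (∑ y ∈ Δg, δg y) * (∑ x ∈ Δf, δf x) * (1 / 4 : ℝ) ^ (2 * n) := by
  have hmod : OneLinkKRModulus 3 (1 / 12) (44 / 25) :=
    su3_oneLinkKRModulus_pv_of_le (q := 126 / 125) (p := 31 / 20)
      (by norm_num) (by norm_num) (by norm_num) (by norm_num) (by norm_num) (by norm_num) (by norm_num)
  have habs : |(1 / 72 : ℝ)| = 1 / 72 := abs_of_pos (by norm_num)
  have hexp : Real.exp (1 / 100 : ℝ) ≤ 51 / 50 := by
    have h := Real.exp_bound_div_one_sub_of_interval' (x := 1 / 100) (by norm_num) (by norm_num)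
    have : (1 : ℝ) / (1 - 1 / 100) ≤ 51 / 50 := by norm_num
    linarith
  have hsqrt : Real.sqrt 3 ≤ 7 / 4 := by
    rw [show (7 / 4 : ℝ) = Real.sqrt ((7 / 4) ^ 2) by rw [Real.sqrt_sq (by norm_num)]]
    exact Real.sqrt_le_sqrt (by norm_num)
  have hcast : Real.sqrt ((3 : ℕ) : ℝ) = Real.sqrt 3 := by norm_num
  have h5 : 0 ≤ Real.sqrt 3 := Real.sqrt_nonneg _
  have h3 : Real.exp (1 / 100) * (1 + 2 * Real.sqrt 3 * (1 / 2000)) ≤ 51 / 50 * (1 + 2 * (7 / 4) * (1 / 2000)) :=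
    mul_le_mul hexp (by linarith) (by positivity) (by norm_num)
  have hE0 : 0 < Real.exp (1 / 100 : ℝ) := Real.exp_pos _
  have h := memBallZdG_abs_cov_le_linfty_sharp (d := 4) (N := 3) (by norm_num) (by norm_num) (β := 1 / 72) (ε₀ := 1 / 100) (ε₁ := 1 / 2000)
    (R := 1) (θ := 1 / 4) (s₀ := 1 / 4) (by norm_num) le_rfl (by rw [habs]; norm_num) hmod hmem ?_ (by norm_num) (by norm_num) ?_ ?_ (by norm_num)
    hμ hfm hfdep hMf hδf hgm hgdep hMg hδg n hdist
  · have e : (4 * ((3 : ℕ) : ℝ) / ((1 / 4 : ℝ) * (1 - 1 / 4))) = 64 := by norm_num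
    rw [e] at h
    exact h
  · rw [habs, hcast]; push_cast; nlinarith [h3, hsqrt, h5, hE0]
  · rw [habs, hcast]
    have hmax : max (2 * (((4 : ℕ) : ℝ) - 1) * ((1 / 4 : ℝ) + (1 / 4)⁻¹ + 1))
        ((1 / 4 : ℝ)⁻¹ ^ 2 + 2 * (1 / 4 : ℝ)⁻¹ + 2 * (1 / 4) + (1 / 4) ^ 2 + 6 * (((4 : ℕ) : ℝ) - 2)) = 585 / 16 := by norm_num
    have hm1 : (2 * 1 + 1 : ℕ) = 3 := by norm_num
    rw [hmax, hm1]
    nlinarith [h3, hsqrt, h5, hE0]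
  · rw [habs, hcast]; push_cast; nlinarith [h3, hsqrt, h5, hE0]

/-! ### The `d = 3` law, sharp form -/

/-- ★★ **THE `ℓ∞`-CLUSTERING LAW, `SU(2)`, `d = 3`, SHARP FORM `θ = √β_W` on `0 < β_W ≤ 1/4`**: for EVERY DLR state of the `SU(2)` Wilson specification on `ℤ³` and ALL
bounded measurable local Lipschitz `f, g` with supports at `ℓ∞`-distance `≥ n`: `|cov_μ(f,g)| ≤ (16/√β_W)(Σδ_g)(Σδ_f) β_W^n` (checks at `t = √β_W ≤ 1/2`: slope
`1/4 + t/2 + 3t²/2 + t³/2 + t⁴/4 ≤ 0.954`, `t + t² + t³ ≤ 0.875`; target `t²(2t+1) ≤ 1/2`; rows `3t² < 1`). [folklore] -/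
theorem su2_abs_cov_le_linfty_sharp_law_dim3 {βW : ℝ} (hβ0 : 0 < βW) (hβ : βW ≤ 1 / 4)
    {μ : Measure (LGConfig 3 (Matrix.specialUnitaryGroup (Fin 2) ℂ))}
    (hμ : μ ∈ ymGibbsMeasures (d := 3) (fundamentalRep (Fin 2)) (2 * (βW / 4)))
    {f g : LGConfig 3 (Matrix.specialUnitaryGroup (Fin 2) ℂ) → ℝ} (hfm : Measurable f) {Δf : Finset (ZdEdge 3)}
    (hfdep : DependsOn f (↑Δf : Set (ZdEdge 3))) {Mf : ℝ} (hMf : ∀ σ, |f σ| ≤ Mf) {δf : ZdEdge 3 → ℝ}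
    (hδf : IsLipBound suFrobDist f δf) (hgm : Measurable g) {Δg : Finset (ZdEdge 3)}
    (hgdep : DependsOn g (↑Δg : Set (ZdEdge 3))) {Mg : ℝ} (hMg : ∀ σ, |g σ| ≤ Mg) {δg : ZdEdge 3 → ℝ}
    (hδg : IsLipBound suFrobDist g δg) (n : ℕ) (hdist : ∀ x ∈ Δf, ∀ y ∈ Δg, (n : ℝ) ≤ ‖x.1 - y.1‖) :
    |cov[f, g; μ]| ≤ 16 / Real.sqrt βW * (∑ y ∈ Δg, δg y) * (∑ x ∈ Δf, δf x) * βW ^ n := by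
  have habs : |βW / 4| = βW / 4 := abs_of_pos (by positivity)
  have hrad : |βW / 4| * (2 * (((3 : ℕ) : ℝ) - 1)) ≤ 1 := by rw [habs]; push_cast; nlinarith
  have hmod := SlabAreaLawDimensions.su2_oneLinkKRModulus_of_le_one hrad
  set t : ℝ := Real.sqrt βW with ht
  have ht0 : 0 < t := Real.sqrt_pos.2 hβ0
  have ht2 : t ^ 2 = βW := Real.sq_sqrt hβ0.le
  have ht1 : t ≤ 1 / 2 := by nlinarith [ht2, ht0]
  have htne : t ≠ 0 := ht0.ne'
  have hθ1 : t ≤ 1 := by linarith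
  have hsup : 1 * |βW / 4| *
      max (2 * (((3 : ℕ) : ℝ) - 1) * (t + t⁻¹ + 1)) (t⁻¹ ^ 2 + 2 * t⁻¹ + 2 * t + t ^ 2 + 6 * (((3 : ℕ) : ℝ) - 2)) ≤ 1 := by
    rw [habs, ← ht2, one_mul]
    have hpar : t ^ 2 / 4 * (2 * (((3 : ℕ) : ℝ) - 1) * (t + t⁻¹ + 1)) ≤ 1 := by
      have e : t ^ 2 / 4 * (2 * (((3 : ℕ) : ℝ) - 1) * (t + t⁻¹ + 1)) = t ^ 3 + t + t ^ 2 := by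
        push_cast; field_simp; ring
      rw [e]; nlinarith [pow_pos ht0 3, pow_le_pow_left₀ ht0.le ht1 2, pow_le_pow_left₀ ht0.le ht1 3]
    have hperp : t ^ 2 / 4 * (t⁻¹ ^ 2 + 2 * t⁻¹ + 2 * t + t ^ 2 + 6 * (((3 : ℕ) : ℝ) - 2)) ≤ 1 := by
      have e : t ^ 2 / 4 * (t⁻¹ ^ 2 + 2 * t⁻¹ + 2 * t + t ^ 2 + 6 * (((3 : ℕ) : ℝ) - 2)) =
          1 / 4 + t / 2 + t ^ 3 / 2 + t ^ 4 / 4 + 3 / 2 * t ^ 2 := by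
        push_cast; field_simp; ring
      rw [e]
      nlinarith [pow_pos ht0 3, pow_pos ht0 4, pow_le_pow_left₀ ht0.le ht1 2, pow_le_pow_left₀ ht0.le ht1 3,
        pow_le_pow_left₀ ht0.le ht1 4]
    rcases le_total (2 * (((3 : ℕ) : ℝ) - 1) * (t + t⁻¹ + 1)) (t⁻¹ ^ 2 + 2 * t⁻¹ + 2 * t + t ^ 2 + 6 * (((3 : ℕ) : ℝ) - 2)) with hle | hle
    · rw [max_eq_right hle]; exact hperp
    · rw [max_eq_left hle]; exact hpar
  have hs0 : 1 * |βW / 4| * (2 * (((3 : ℕ) : ℝ) - 1) * (2 * t + 1)) ≤ 1 / 2 := by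
    rw [habs, ← ht2]; push_cast; nlinarith [pow_pos ht0 3, pow_le_pow_left₀ ht0.le ht1 2, pow_le_pow_left₀ ht0.le ht1 3]
  have hρ : 6 * (((3 : ℕ) : ℝ) - 1) * |βW / 4| * 1 < 1 := by rw [habs, ← ht2]; push_cast; nlinarith
  have h := ym_abs_cov_le_linfty_sharp (d := 3) (N := 2) (by norm_num) (by norm_num) (β := βW / 4) (K := 1) zero_le_one le_rfl hmod
    hρ ht0 hθ1 hsup hs0 (by norm_num) (μ := μ) (by
      have e : ((2 : ℕ) : ℝ) * (βW / 4) = 2 * (βW / 4) := by norm_num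
      rw [e]; exact hμ) hfm hfdep hMf hδf hgm hgdep hMg hδg n hdist
  have e1 : (4 * ((2 : ℕ) : ℝ) / (t * (1 - 1 / 2))) = 16 / t := by
    field_simp; ring
  have e2 : t ^ (2 * n) = βW ^ n := by rw [pow_mul, ht2]
  rw [e1, e2] at h
  exact h

end Summit.Ventures.YMGap.RobustBall.ZdAxis

end
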